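import Literature.MathematicalPhysics.QuantumFieldTheory.Balaban1983to89.B7Prop3GeneralRotated
import HarnessLib

/-!
# `UnitScaleTiltProp7CornerCombLoopDefects` — F-6b-cov, part 1: transport defects on `ℤᵈ` from the plaquette bound alone
(closed-loop holonomies `‖V(Γ) − 1‖ ≤ |Γ|²·a`, two-path transport comparison `‖R(V(Γ₁))X − R(V(Γ₂))X‖ ≤ 2(|Γ₁|+|Γ₂|)²a·‖X‖`,
and the exact telescoping of a transported shift by `L•e_ν` into `L` transported covariant differences)

«(O2) groundwork — not consumed by any displayed row before the freeze lifts» (★★OWNER ym3-torus-plan g29 RULINGS №19 (O2), №20 (2),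
№22 (c); «(II) GO» of record 2026-08-29T06:31:31Z; pen F-6b named by ★routeR-w1 g9 07:35:40Z «flat identity first, dressing second»).
This is the dressing kit for the covariant gradient transfer F-6b-cov (MASTER 6efb31c3 §1 row 6 «`L^{(4−d)∕2} + c₃L²p_j`»): every
comparison of two background transports from the block corner `q` to the same site is a CLOSED-LOOP holonomy, and a closed loop of length `ℓ`
based at `q` has `‖V(Γ) − 1‖ ≤ ℓ·ℓ·a` as soon as every plaquette holonomy is within `a` of `1` — by the tree-axial gauge at `q` (lit
✓`B7Prop1Explicit.axial_bond_bound`: the axially gauged bond at `x` is within `|x − q|₁·a` of `1`, and `|x − q|₁ ≤ ℓ` along the loop) and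
gauge invariance of based loops (lit ✓`hol_gaugeAct_closed`, ✓`norm_sub_one_le_of_conj`).  No Stokes surface bookkeeping, no print constant.
* §1 ★`norm_hol_axial_sub_one_le` — along any word from `x`, the axially gauged holonomy is within `|w|·(|x−q|₁ + |w|)·a` of `1`;
  ★★`norm_hol_closed_sub_one_le` — `disp w = 0 ⇒ ‖V(w from q) − 1‖ ≤ |w|·|w|·a`.
* §2 ★★`norm_conjR_hol_sub_conjR_hol_le` — two words `p₁, p₂` from `q` with the same displacement:
  `‖R(V(p₁))X − R(V(p₂))X‖ ≤ 2·(|p₁|+|p₂|)·(|p₁|+|p₂|)·a·‖X‖` (lit ✓`B8CurlGradHolonomy.norm_conj_sub_le` on the loop `revWord p₂ ++ p₁`).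
* §3 ★`conjR_hol_append_seg_sub_eq_sum` — EXACT telescoping: for a word `p` from `q` ending at `w` and a site function `F`,
  `R(V(p ++ seg ν L)) F(w + L•e_ν) − R(V(p)) F(w) = Σ_{s<L} R(V(p ++ seg ν s)) [R(V(w + s•e_ν, ν)) F(w + (s+1)•e_ν) − F(w + s•e_ν)]`
  — the coarse shift is `L` TRANSPORTED covariant unit differences, with no defect at all (the defects of F-6b-cov come only from re-basing
  transports, §2).
Any `d`; `𝔸` any normed ring with `‖1‖ = 1`; `V` with values in lit `U1` (norm ≤ 1 with inverse of norm ≤ 1 — unitary matrices).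
HONEST: transport bookkeeping; nothing of `hMcomb` ∕ `hMcomb₂` ∕ (β) ∕ `hD` ∕ the crux 19200 is proved or claimed; rung R3 (YM₃ on T³), not d = 4,
not infinite volume, not a mass gap, not Clay.
-/

open scoped BigOperators
open Finset
open Literature.MathematicalPhysics.QuantumFieldTheory.Balaban1983to89
open Literature.MathematicalPhysics.QuantumFieldTheory.Balaban1983to89.B7Prop1Explicit
open Literature.MathematicalPhysics.QuantumFieldTheory.Balaban1983to89.B7Eq78Linearization (conjR conjR_apply conjR_sub)
open Literature.MathematicalPhysics.QuantumFieldTheory.Balaban1983to89.B7Prop3GeneralRotated (conjR_mul_left norm_conjR_le)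

namespace Summit.QuantumFields.YangMills.Theorems.Prop7CornerCombLoopDefects

variable {d : ℕ} {𝔸 : Type*} [NormedRing 𝔸] [NormOneClass 𝔸]

/-! ## §1 Closed loops from the plaquette bound, via the tree-axial gauge -/

omit [NormOneClass 𝔸] in
/-- Product of a near-`1` element of norm `≤ 1` with a near-`1` element: `‖g·h − 1‖ ≤ ‖g − 1‖ + ‖h − 1‖` when `‖g‖ ≤ 1` (a private local copy
of lit ✓`B8Ineq170.norm_mul_sub_one_le_of_norm_le_one`, kept private to keep the import closure small). [folklore] -/
private theorem norm_mul_sub_one_le {g h : 𝔸} (hg : ‖g‖ ≤ 1) : ‖g * h - 1‖ ≤ ‖g - 1‖ + ‖h - 1‖ := by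
  have e : g * h - 1 = g * (h - 1) + (g - 1) := by noncomm_ring
  rw [e]
  calc ‖g * (h - 1) + (g - 1)‖ ≤ ‖g * (h - 1)‖ + ‖g - 1‖ := norm_add_le _ _
    _ ≤ ‖g‖ * ‖h - 1‖ + ‖g - 1‖ := by gcongr; exact norm_mul_le _ _
    _ ≤ 1 * ‖h - 1‖ + ‖g - 1‖ := by gcongr
    _ = ‖g - 1‖ + ‖h - 1‖ := by rw [one_mul, add_comm]

/-- ★ **Axial holonomies along any word**: in the tree-axial gauge at `q` (lit `axialFn`), with every plaquette holonomy within `a` of `1`, the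
holonomy of a word `w` walked from `x` is within `|w|·((|x − q|₁ + |w|)·a)` of `1` (each bond along the way sits at `ℓ¹`-distance
`≤ |x − q|₁ + |w|` from `q`, lit ✓`axial_bond_bound`, ✓`l1_disp_le`). [cite: Balaban1985Averaging, (44)-(47) pp.24-25] -/
theorem norm_hol_axial_sub_one_le (V : Site d → Fin d → 𝔸ˣ) (hV : ∀ x κ, V x κ ∈ U1 𝔸) (q : Site d) {a : ℝ} (ha : 0 ≤ a)
    (hplaq : ∀ (x : Site d) (κ μ : Fin d), κ ≠ μ → ‖((hol V x (plaqWord κ μ) : 𝔸ˣ) : 𝔸) - 1‖ ≤ a) :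
    ∀ (x : Site d) (w : List (Letter d)),
      ‖((hol (gaugeAct (axialFn V q) V) x w : 𝔸ˣ) : 𝔸) - 1‖ ≤ w.length * (((l1 (x - q) : ℕ) + w.length) * a)
  | x, [] => by simp
  | x, l :: w => by
    have hWm : ∀ y κ, gaugeAct (axialFn V q) V y κ ∈ U1 𝔸 := gaugeAct_mem hV (axialFn_mem hV q)
    rw [hol_cons, Units.val_mul]
    have ih := norm_hol_axial_sub_one_le V hV q ha hplaq (x + l.vec) w
    -- the first bond: forward `W(x, μ)`, backward `W(x − e_μ, μ)⁻¹`, both within `(|x−q|₁ + 1)·a` of `1`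
    have hstep : ‖((stepHol (gaugeAct (axialFn V q) V) x l : 𝔸ˣ) : 𝔸) - 1‖ ≤ (((l1 (x - q) : ℕ) : ℝ) + 1) * a := by
      obtain ⟨μ, b⟩ := l
      cases b
      · rw [stepHol_false]
        refine (norm_inv_sub_one_le (hWm _ _)).trans ((axial_bond_bound V hV q hplaq ha _ μ).trans ?_)
        gcongr
        have : x - e μ - q = (x - q) + (-e μ) := by abel
        rw [this]
        refine (Nat.cast_le.mpr (l1_add_le _ _)).trans ?_
        rw [show -e μ = Letter.vec (μ, false) by simp [Letter.vec_false], l1_vec]; push_cast; rfl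
      · rw [stepHol_true]
        refine (axial_bond_bound V hV q hplaq ha x μ).trans ?_
        gcongr
        linarith
    have hstepn : ‖((stepHol (gaugeAct (axialFn V q) V) x l : 𝔸ˣ) : 𝔸)‖ ≤ 1 := by
      obtain ⟨μ, b⟩ := l
      cases b
      · rw [stepHol_false]; exact (hWm _ _).2
      · rw [stepHol_true]; exact (hWm _ _).1
    -- the tail starts at `x + vec l`, one step further from `q`
    have hl1 : ((l1 (x + l.vec - q) : ℕ) : ℝ) ≤ ((l1 (x - q) : ℕ) : ℝ) + 1 := by
      have : x + l.vec - q = (x - q) + l.vec := by abel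
      rw [this]
      have h := l1_add_le (x - q) l.vec
      rw [l1_vec] at h
      exact_mod_cast h
    have ih' : ‖((hol (gaugeAct (axialFn V q) V) (x + l.vec) w : 𝔸ˣ) : 𝔸) - 1‖
        ≤ w.length * ((((l1 (x - q) : ℕ) : ℝ) + 1 + w.length) * a) := by
      refine ih.trans (mul_le_mul_of_nonneg_left (mul_le_mul_of_nonneg_right (by linarith) ha) (Nat.cast_nonneg _))
    calc _ ≤ ‖((stepHol (gaugeAct (axialFn V q) V) x l : 𝔸ˣ) : 𝔸) - 1‖
          + ‖((hol (gaugeAct (axialFn V q) V) (x + l.vec) w : 𝔸ˣ) : 𝔸) - 1‖ := norm_mul_sub_one_le hstepn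
      _ ≤ (((l1 (x - q) : ℕ) : ℝ) + 1) * a + w.length * ((((l1 (x - q) : ℕ) : ℝ) + 1 + w.length) * a) := add_le_add hstep ih'
      _ ≤ ((l :: w).length : ℝ) * ((((l1 (x - q) : ℕ) : ℝ) + (l :: w).length) * a) := by
          simp only [List.length_cons, Nat.cast_succ]
          have h0 : (0 : ℝ) ≤ (w.length : ℝ) := Nat.cast_nonneg _
          have h1 : (0 : ℝ) ≤ ((l1 (x - q) : ℕ) : ℝ) := Nat.cast_nonneg _
          nlinarith

/-- ★★ **CLOSED LOOPS FROM THE PLAQUETTE BOUND**: if every plaquette holonomy of the `U1`-valued `V` is within `a` of `1`, then every CLOSED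
word `w` (`disp w = 0`) based at `q` has `‖V(w) − 1‖ ≤ |w|·(|w|·a)` — gauge the loop axially at `q` (lit ✓`hol_gaugeAct_closed`,
✓`norm_sub_one_le_of_conj`) and use ★`norm_hol_axial_sub_one_le`. [cite: Balaban1985Averaging, (44)-(47) pp.24-25] -/
theorem norm_hol_closed_sub_one_le (V : Site d → Fin d → 𝔸ˣ) (hV : ∀ x κ, V x κ ∈ U1 𝔸) {a : ℝ} (ha : 0 ≤ a)
    (hplaq : ∀ (x : Site d) (κ μ : Fin d), κ ≠ μ → ‖((hol V x (plaqWord κ μ) : 𝔸ˣ) : 𝔸) - 1‖ ≤ a)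
    (q : Site d) (w : List (Letter d)) (hw : disp w = 0) :
    ‖((hol V q w : 𝔸ˣ) : 𝔸) - 1‖ ≤ w.length * (w.length * a) := by
  have hconj := hol_gaugeAct_closed (axialFn V q) V q w hw
  have h1 : ‖((hol V q w : 𝔸ˣ) : 𝔸) - 1‖ ≤ ‖((hol (gaugeAct (axialFn V q) V) q w : 𝔸ˣ) : 𝔸) - 1‖ := by
    rw [hconj]
    exact norm_sub_one_le_of_conj (axialFn_mem hV q q)
  refine h1.trans ((norm_hol_axial_sub_one_le V hV q ha hplaq q w).trans (le_of_eq ?_))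
  simp [l1]

/-! ## §2 Two transports to the same site differ by a loop -/

/-- ★★ **RE-BASING A TRANSPORT COSTS A LOOP**: two words `p₁, p₂` from `q` with the same displacement give conjugations that differ by at most
`2·(|p₁|+|p₂|)·((|p₁|+|p₂|)·a)·‖X‖` (the loop `revWord p₂ ++ p₁` through ★★`norm_hol_closed_sub_one_le` and lit
✓`B8CurlGradHolonomy.norm_conj_sub_le`). [cite: Balaban1985Averaging, (44)-(47) pp.24-25] -/
theorem norm_conjR_hol_sub_conjR_hol_le (V : Site d → Fin d → 𝔸ˣ) (hV : ∀ x κ, V x κ ∈ U1 𝔸) {a : ℝ} (ha : 0 ≤ a)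
    (hplaq : ∀ (x : Site d) (κ μ : Fin d), κ ≠ μ → ‖((hol V x (plaqWord κ μ) : 𝔸ˣ) : 𝔸) - 1‖ ≤ a)
    (q : Site d) (p₁ p₂ : List (Letter d)) (hp : disp p₁ = disp p₂) (X : 𝔸) :
    ‖conjR (hol V q p₁) X - conjR (hol V q p₂) X‖
      ≤ 2 * ((p₁.length + p₂.length : ℕ) * ((p₁.length + p₂.length : ℕ) * a)) * ‖X‖ := by
  set P₁ : 𝔸ˣ := hol V q p₁ with hP₁
  set P₂ : 𝔸ˣ := hol V q p₂ with hP₂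
  have hP₂m : P₂ ∈ U1 𝔸 := hol_mem hV _ _
  -- `R(P₁)X − R(P₂)X = R(P₂)(R(P₂⁻¹P₁)X − X)`
  have hfac : conjR P₁ X - conjR P₂ X = conjR P₂ (conjR (P₂⁻¹ * P₁) X - X) := by
    rw [conjR_sub, ← conjR_mul_left, mul_inv_cancel_left]
  -- `P₂⁻¹P₁` is the holonomy of the CLOSED word `revWord p₂ ++ p₁` based at the common endpoint
  have hloop : P₂⁻¹ * P₁ = hol V (q + disp p₂) (revWord p₂ ++ p₁) := by
    rw [hol_append, disp_revWord, hol_revWord' V (x := q) (q + disp p₂) p₂ rfl, hP₁, hP₂]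
    congr 1
    rw [add_neg_cancel_right]
  have hclosed : disp (revWord p₂ ++ p₁) = 0 := by rw [disp_append, disp_revWord, hp, neg_add_cancel]
  have hlen : (revWord p₂ ++ p₁).length = p₁.length + p₂.length := by rw [List.length_append, length_revWord, add_comm]
  have hL := norm_hol_closed_sub_one_le V hV ha hplaq (q + disp p₂) (revWord p₂ ++ p₁) hclosed
  rw [hlen, ← hloop] at hL
  rw [hfac]
  calc ‖conjR P₂ (conjR (P₂⁻¹ * P₁) X - X)‖ ≤ ‖conjR (P₂⁻¹ * P₁) X - X‖ := norm_conjR_le hP₂m _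
    _ ≤ 2 * ‖((P₂⁻¹ * P₁ : 𝔸ˣ) : 𝔸) - 1‖ * ‖X‖ := by
        rw [conjR_apply]
        exact B8CurlGradHolonomy.norm_conj_sub_le _ _ (Subgroup.mul_mem _ (Subgroup.inv_mem _ hP₂m) (hol_mem hV _ _)).2
    _ ≤ 2 * ((p₁.length + p₂.length : ℕ) * ((p₁.length + p₂.length : ℕ) * a)) * ‖X‖ := by gcongr

/-! ## §3 A transported coarse shift is `L` transported covariant unit differences — exactly -/

omit [NormOneClass 𝔸] in
/-- ★ **EXACT TELESCOPING WITH TRANSPORTS**: for a word `p` from `q` (ending at `w = q + disp p`), a direction `ν` and a site function `F`,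
`R(V(p ++ seg ν L)) F(w + L•e_ν) − R(V(p)) F(w) = Σ_{s<L} R(V(p ++ seg ν s)) ( R(V(w + s•e_ν, ν)) F(w + s•e_ν + e_ν) − F(w + s•e_ν) )`.
[folklore] [cite: Balaban1984PropagatorsI, (1.18)-(1.20) pp.19-20] -/
theorem conjR_hol_append_seg_sub_eq_sum (V : Site d → Fin d → 𝔸ˣ) (q : Site d) (p : List (Letter d)) (ν : Fin d) (F : Site d → 𝔸) :
    ∀ L : ℕ, conjR (hol V q (p ++ seg ν (L : ℤ))) (F (q + disp p + (L : ℤ) • e ν)) - conjR (hol V q p) (F (q + disp p))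
      = ∑ s ∈ Finset.range L, conjR (hol V q (p ++ seg ν (s : ℤ)))
          (conjR (V (q + disp p + (s : ℤ) • e ν) ν) (F (q + disp p + (s : ℤ) • e ν + e ν)) - F (q + disp p + (s : ℤ) • e ν))
  | 0 => by simp
  | L + 1 => by
    rw [Finset.sum_range_succ, ← conjR_hol_append_seg_sub_eq_sum V q p ν F L, conjR_sub, ← conjR_mul_left, ← hol_seg_natCast_succ_append]
    have e1 : q + disp p + (L : ℤ) • e ν + e ν = q + disp p + ((L + 1 : ℕ) : ℤ) • e ν := by
      push_cast; rw [add_smul, one_smul, add_assoc]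
    rw [e1]
    abel
where
  /-- `hol` over `p ++ seg ν (s+1)` factors as `hol (p ++ seg ν s) · V(endpoint + s•e_ν, ν)`. [folklore] -/
  hol_seg_natCast_succ_append : ∀ s : ℕ,
      hol V q (p ++ seg ν (s : ℤ)) * V (q + disp p + (s : ℤ) • e ν) ν = hol V q (p ++ seg ν ((s + 1 : ℕ) : ℤ)) := by
    intro s
    rw [hol_append, hol_append, mul_assoc, ← hol_seg_natCast_succ]
    push_cast
    rfl

end Summit.QuantumFields.YangMills.Theorems.Prop7CornerCombLoopDefects
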